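import Mathlib
import HarnessLib

/-!
# Order-shattering (Anstee–Rónyai–Sali): the recursion and the counting identity `#osh(ℱ) = #ℱ`

Topic `Literature/Combinatorics/SetFamily`.

**Sources.** R. P. Anstee, L. Rónyai, A. Sali, *Shattering news*, Graphs and Combinatorics **18** (2002)
59–73 [AnsteeRonyaiSali2002] (not held; the definition and the counting identity are transcribed from the
held secondary source J. *et al.*, *More Shattering News*, arXiv:2603.18708, Definition 1.3 and the paragraph
after it, which restate them verbatim and attribute them to [AnsteeRonyaiSali2002]).

**Printed statement** (arXiv:2603.18708, Def. 1.3): "If `S = ∅`, then `S` is order shattered by `𝓕` as long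
as `𝓕 ≠ ∅`.  If `|S| = k ≥ 1`, let the elements in `S` be `s₁ < s₂ < ⋯ < s_k`. We say that `S` is order
shattered by `𝓕` if there exist disjoint families `𝓕₀~, 𝓕₁~ ⊆ 𝓕`, each of size `2^{|S|-1}`, so that if we
let `T = [s_k+1, n]` (possibly `T = ∅`), then the following hold. • `T ∩ C = T ∩ D` for all `C ∈ 𝓕₀~` and
`D ∈ 𝓕₁~`. • `{s_k} ∩ C = ∅` and `{s_k} ∩ D = {s_k}` for all `C ∈ 𝓕₀~` and `D ∈ 𝓕₁~`. • Each of `𝓕₀~` and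
`𝓕₁~` individually order shatters `S ∖ {s_k}`."  And: "`osh(𝓕)` is a downset, …, `osh(𝓕) = osh(𝓕ᶜ)` …
Moreover, by [AnsteeRonyaiSali2002], `|osh(𝓕)| = |𝓕|`, which in particular proves the Reverse Sauer Inequality."

**Design.** We take the equivalent recursion on the LARGEST coordinate (the one used in the proof of
`|osh| = |𝓕|` in [AnsteeRonyaiSali2002, §2]): listing the coordinates from the largest down as
`l = [x₁, x₂, …]`, with `𝓕₀ = {F : x₁ ∉ F}` and `𝓕₁ = {F.erase x₁ : x₁ ∈ F}` one has
`osh(𝓕) = osh(𝓕₀) ∪ osh(𝓕₁) ∪ {insert x₁ S : S ∈ osh(𝓕₀) ∩ osh(𝓕₁)}` (all members of a class "agreeing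
on `T`" lie on the same side of `x₁` when `x₁ > max S`, and the two sides are exactly `𝓕₀`, `𝓕₁` when
`x₁ = max S`).  This makes `osh l 𝓕` a computable `Finset` and the counting identity a short induction on `l`;
the linear order is the position in `l` (no `LinearOrder α` needed).
-- TODO(general form): the equivalence with the class-based Definition 1.3 for `l = [n, n-1, …, 1]`, and the
-- standard-monomial / linear-independence statements of [AnsteeRonyaiSali2002, §3] are not formalised here.

Main results: `osh`, `card_osh` (`#(osh l 𝓕) = #𝓕`), `osh_witness` (a member containing `S` and a member
disjoint from `S` agreeing on all coordinates listed before the first coordinate of `S`).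
-/

namespace Literature.Combinatorics.SetFamily

open Finset

variable {α : Type*} [DecidableEq α]

/-- Order-shattered sets of a family `ℱ` along the coordinate list `l` (largest coordinate first),
by the Anstee–Rónyai–Sali recursion. [cite: AnsteeRonyaiSali2002, §2] -/
def osh : List α → Finset (Finset α) → Finset (Finset α)
  | [], ℱ => if ℱ.Nonempty then {∅} else ∅
  | (x :: l), ℱ =>
      osh l (ℱ.filter (fun F => x ∉ F)) ∪ osh l ((ℱ.filter (fun F => x ∈ F)).image (fun F => F.erase x))
        ∪ ((osh l (ℱ.filter (fun F => x ∉ F)) ∩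
            osh l ((ℱ.filter (fun F => x ∈ F)).image (fun F => F.erase x))).image (insert x))

/-- Unfolding lemma for `osh` on a cons. [folklore] -/
private theorem osh_cons (x : α) (l : List α) (ℱ : Finset (Finset α)) :
    osh (x :: l) ℱ =
      osh l (ℱ.filter (fun F => x ∉ F)) ∪ osh l ((ℱ.filter (fun F => x ∈ F)).image (fun F => F.erase x))
        ∪ ((osh l (ℱ.filter (fun F => x ∉ F)) ∩
            osh l ((ℱ.filter (fun F => x ∈ F)).image (fun F => F.erase x))).image (insert x)) := rfl

/-- Unfolding lemma for `osh` on the empty list. [folklore] -/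
private theorem osh_nil (ℱ : Finset (Finset α)) : osh [] ℱ = if ℱ.Nonempty then {∅} else ∅ := rfl

/-- Order-shattered sets live inside the coordinate list (`osh(𝓕) ⊆ 2^{[n]}`). [cite: AnsteeRonyaiSali2002, §2] -/
theorem osh_subset_toFinset : ∀ (l : List α) (ℱ : Finset (Finset α)),
    (∀ F ∈ ℱ, F ⊆ l.toFinset) → ∀ S ∈ osh l ℱ, S ⊆ l.toFinset := by
  intro l
  induction l with
  | nil =>
      intro ℱ _ S hS
      rw [osh_nil] at hS
      split_ifs at hS with h
      · rw [Finset.mem_singleton] at hS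
        rw [hS]
        exact Finset.empty_subset _
      · exact absurd hS (Finset.notMem_empty S)
  | cons x l ih =>
      intro ℱ hℱ S hS
      have h0 : ∀ F ∈ ℱ.filter (fun F => x ∉ F), F ⊆ l.toFinset := by
        intro F hF
        rcases Finset.mem_filter.1 hF with ⟨hFℱ, hxF⟩
        intro y hy
        have hy' := hℱ F hFℱ hy
        rw [List.toFinset_cons, Finset.mem_insert] at hy'
        rcases hy' with rfl | hy'
        · exact absurd hy hxF
        · exact hy'
      have h1 : ∀ F ∈ (ℱ.filter (fun F => x ∈ F)).image (fun F => F.erase x), F ⊆ l.toFinset := by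
        intro G hG
        rcases Finset.mem_image.1 hG with ⟨F, hF, rfl⟩
        rcases Finset.mem_filter.1 hF with ⟨hFℱ, _⟩
        intro y hy
        rcases Finset.mem_erase.1 hy with ⟨hyx, hyF⟩
        have hy' := hℱ F hFℱ hyF
        rw [List.toFinset_cons, Finset.mem_insert] at hy'
        rcases hy' with rfl | hy'
        · exact absurd rfl hyx
        · exact hy'
      rw [osh_cons] at hS
      rw [List.toFinset_cons]
      rcases Finset.mem_union.1 hS with hS | hS
      · rcases Finset.mem_union.1 hS with hS | hS
        · exact (ih _ h0 S hS).trans (Finset.subset_insert _ _)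
        · exact (ih _ h1 S hS).trans (Finset.subset_insert _ _)
      · rcases Finset.mem_image.1 hS with ⟨S', hS', rfl⟩
        rcases Finset.mem_inter.1 hS' with ⟨hS'0, _⟩
        exact Finset.insert_subset_insert _ (ih _ h0 S' hS'0)

/-- **Counting identity** `#osh = #ℱ` (Anstee–Rónyai–Sali): along a duplicate-free coordinate list containing
every member, a family has exactly as many order-shattered sets as members. [cite: AnsteeRonyaiSali2002, §2] -/
theorem card_osh : ∀ (l : List α), l.Nodup → ∀ (ℱ : Finset (Finset α)),
    (∀ F ∈ ℱ, F ⊆ l.toFinset) → #(osh l ℱ) = #ℱ := by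
  intro l
  induction l with
  | nil =>
      intro _ ℱ hℱ
      have hsub : ℱ ⊆ {∅} := by
        intro F hF
        rw [Finset.mem_singleton]
        exact Finset.subset_empty.1 (by simpa using hℱ F hF)
      rw [osh_nil]
      split_ifs with h
      · rcases h with ⟨F, hF⟩
        have hF' : F = ∅ := Finset.mem_singleton.1 (hsub hF)
        have : ℱ = {∅} := Finset.Subset.antisymm hsub (by
          intro G hG; rw [Finset.mem_singleton] at hG; rw [hG, ← hF']; exact hF)
        rw [this]
      · rw [Finset.not_nonempty_iff_eq_empty.1 h]
  | cons x l ih =>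
      intro hnd ℱ hℱ
      rw [List.nodup_cons] at hnd
      rcases hnd with ⟨hxl, hl⟩
      set ℱ₀ := ℱ.filter (fun F => x ∉ F) with hℱ₀
      set ℱ₁ := ℱ.filter (fun F => x ∈ F) with hℱ₁
      set ℱ₁' := ℱ₁.image (fun F => F.erase x) with hℱ₁'
      have h0 : ∀ F ∈ ℱ₀, F ⊆ l.toFinset := by
        intro F hF
        rcases Finset.mem_filter.1 hF with ⟨hFℱ, hxF⟩
        intro y hy
        have hy' := hℱ F hFℱ hy
        rw [List.toFinset_cons, Finset.mem_insert] at hy'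
        rcases hy' with rfl | hy'
        · exact absurd hy hxF
        · exact hy'
      have h1 : ∀ F ∈ ℱ₁', F ⊆ l.toFinset := by
        intro G hG
        rcases Finset.mem_image.1 hG with ⟨F, hF, rfl⟩
        rcases Finset.mem_filter.1 hF with ⟨hFℱ, _⟩
        intro y hy
        rcases Finset.mem_erase.1 hy with ⟨hyx, hyF⟩
        have hy' := hℱ F hFℱ hyF
        rw [List.toFinset_cons, Finset.mem_insert] at hy'
        rcases hy' with rfl | hy'
        · exact absurd rfl hyx
        · exact hy'
      set A := osh l ℱ₀ with hA
      set B := osh l ℱ₁' with hB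
      have hAx : ∀ S ∈ A, x ∉ S := fun S hS hx =>
        hxl (List.mem_toFinset.1 (osh_subset_toFinset l ℱ₀ h0 S hS hx))
      have hBx : ∀ S ∈ B, x ∉ S := fun S hS hx =>
        hxl (List.mem_toFinset.1 (osh_subset_toFinset l ℱ₁' h1 S hS hx))
      -- the three pieces
      have hdisj : Disjoint (A ∪ B) ((A ∩ B).image (insert x)) := by
        rw [Finset.disjoint_left]
        intro S hS hS'
        rcases Finset.mem_image.1 hS' with ⟨S', _, rfl⟩
        have hx : x ∉ insert x S' := by
          rcases Finset.mem_union.1 hS with h | h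
          · exact hAx _ h
          · exact hBx _ h
        exact hx (Finset.mem_insert_self x S')
      have hinj : Set.InjOn (insert x) ((A ∩ B : Finset (Finset α)) : Set (Finset α)) := by
        intro S hS S' hS' hEq
        have hxS : x ∉ S := hAx S (Finset.mem_inter.1 (Finset.mem_coe.1 hS)).1
        have hxS' : x ∉ S' := hAx S' (Finset.mem_inter.1 (Finset.mem_coe.1 hS')).1
        rw [← Finset.erase_insert hxS, ← Finset.erase_insert hxS', hEq]
      have hinj1 : Set.InjOn (fun F : Finset α => F.erase x) (ℱ₁ : Set (Finset α)) := by
        intro F hF F' hF' hEq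
        have hxF : x ∈ F := (Finset.mem_filter.1 (Finset.mem_coe.1 hF)).2
        have hxF' : x ∈ F' := (Finset.mem_filter.1 (Finset.mem_coe.1 hF')).2
        have := congrArg (insert x) hEq
        simp only [Finset.insert_erase hxF, Finset.insert_erase hxF'] at this
        exact this
      rw [osh_cons, Finset.card_union_of_disjoint hdisj, Finset.card_image_of_injOn hinj,
        Finset.card_union_add_card_inter]
      have hA' : #A = #ℱ₀ := ih hl ℱ₀ h0
      have hB' : #B = #ℱ₁ := by
        rw [hB, ih hl ℱ₁' h1, hℱ₁', Finset.card_image_of_injOn hinj1]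
      rw [hA', hB', hℱ₀, hℱ₁]
      have h := Finset.card_filter_add_card_filter_not (s := ℱ) (fun F => x ∉ F)
      simp only [not_not] at h
      exact h

/-- **Witnesses of order-shattering.**  If `S ∈ osh l ℱ` then some member contains `S`, some member is
disjoint from `S`, and the two agree on every coordinate of `l` that precedes the first coordinate of
`S` in `l` (for `l` listing coordinates from the largest down: they agree above `max S`).
In particular the largest coordinate at which they differ is `max S`. [cite: AnsteeRonyaiSali2002, §2 (Definition: the families `𝓕₀~ ∋ C`, `𝓕₁~ ∋ D` with `T ∩ C = T ∩ D`)] -/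
theorem osh_witness : ∀ (l : List α), l.Nodup → ∀ (ℱ : Finset (Finset α)),
    (∀ F ∈ ℱ, F ⊆ l.toFinset) → ∀ S ∈ osh l ℱ,
    ∃ F ∈ ℱ, ∃ F' ∈ ℱ, S ⊆ F ∧ Disjoint S F' ∧
      ∀ y ∈ l.takeWhile (fun y => decide (y ∉ S)), (y ∈ F ↔ y ∈ F') := by
  intro l
  induction l with
  | nil =>
      intro _ ℱ _ S hS
      rw [osh_nil] at hS
      split_ifs at hS with h
      · rcases h with ⟨F, hF⟩
        rw [Finset.mem_singleton] at hS
        subst hS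
        exact ⟨F, hF, F, hF, Finset.empty_subset _, Finset.disjoint_empty_left _, by simp⟩
      · exact absurd hS (Finset.notMem_empty S)
  | cons x l ih =>
      intro hnd ℱ hℱ S hS
      rw [List.nodup_cons] at hnd
      rcases hnd with ⟨hxl, hl⟩
      have h0 : ∀ F ∈ ℱ.filter (fun F => x ∉ F), F ⊆ l.toFinset := by
        intro F hF
        rcases Finset.mem_filter.1 hF with ⟨hFℱ, hxF⟩
        intro y hy
        have hy' := hℱ F hFℱ hy
        rw [List.toFinset_cons, Finset.mem_insert] at hy'
        rcases hy' with rfl | hy'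
        · exact absurd hy hxF
        · exact hy'
      have h1 : ∀ F ∈ (ℱ.filter (fun F => x ∈ F)).image (fun F => F.erase x), F ⊆ l.toFinset := by
        intro G hG
        rcases Finset.mem_image.1 hG with ⟨F, hF, rfl⟩
        rcases Finset.mem_filter.1 hF with ⟨hFℱ, _⟩
        intro y hy
        rcases Finset.mem_erase.1 hy with ⟨hyx, hyF⟩
        have hy' := hℱ F hFℱ hyF
        rw [List.toFinset_cons, Finset.mem_insert] at hy'
        rcases hy' with rfl | hy'
        · exact absurd rfl hyx
        · exact hy'
      rw [osh_cons] at hS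
      rcases Finset.mem_union.1 hS with hS | hS
      · rcases Finset.mem_union.1 hS with hS | hS
        · -- S ∈ osh l ℱ₀
          have hxS : x ∉ S := fun hx =>
            hxl (List.mem_toFinset.1 (osh_subset_toFinset l _ h0 S hS hx))
          rcases ih hl _ h0 S hS with ⟨F, hF, F', hF', hSF, hSF', hagree⟩
          rcases Finset.mem_filter.1 hF with ⟨hFℱ, hxF⟩
          rcases Finset.mem_filter.1 hF' with ⟨hF'ℱ, hxF'⟩
          refine ⟨F, hFℱ, F', hF'ℱ, hSF, hSF', ?_⟩
          intro y hy
          rw [List.takeWhile_cons_of_pos (by simpa using hxS)] at hy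
          rcases List.mem_cons.1 hy with rfl | hy
          · exact ⟨fun h => absurd h hxF, fun h => absurd h hxF'⟩
          · exact hagree y hy
        · -- S ∈ osh l ℱ₁'
          have hxS : x ∉ S := fun hx =>
            hxl (List.mem_toFinset.1 (osh_subset_toFinset l _ h1 S hS hx))
          rcases ih hl _ h1 S hS with ⟨G, hG, G', hG', hSG, hSG', hagree⟩
          rcases Finset.mem_image.1 hG with ⟨F, hF, rfl⟩
          rcases Finset.mem_image.1 hG' with ⟨F', hF', rfl⟩
          rcases Finset.mem_filter.1 hF with ⟨hFℱ, hxF⟩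
          rcases Finset.mem_filter.1 hF' with ⟨hF'ℱ, hxF'⟩
          refine ⟨F, hFℱ, F', hF'ℱ, hSG.trans (Finset.erase_subset _ _), ?_, ?_⟩
          · rw [Finset.disjoint_left] at hSG' ⊢
            intro y hyS hyF'
            exact hSG' hyS (Finset.mem_erase.2 ⟨fun h => hxS (h ▸ hyS), hyF'⟩)
          · intro y hy
            rw [List.takeWhile_cons_of_pos (by simpa using hxS)] at hy
            rcases List.mem_cons.1 hy with rfl | hy
            · exact ⟨fun _ => hxF', fun _ => hxF⟩
            · have hyl : y ∈ l := (List.takeWhile_sublist _).subset hy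
              have hyx : y ≠ x := fun h => hxl (h ▸ hyl)
              have h' := hagree y hy
              simp only [Finset.mem_erase, ne_eq, hyx, not_false_eq_true, true_and] at h'
              exact h'
      · -- S = insert x S' with S' order-shattered by both halves
        rcases Finset.mem_image.1 hS with ⟨S', hS', rfl⟩
        rcases Finset.mem_inter.1 hS' with ⟨hS'0, hS'1⟩
        rcases ih hl _ h0 S' hS'0 with ⟨_, _, F', hF', _, hSF', _⟩
        rcases ih hl _ h1 S' hS'1 with ⟨G, hG, _, _, hSG, _, _⟩
        rcases Finset.mem_image.1 hG with ⟨F, hF, rfl⟩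
        rcases Finset.mem_filter.1 hF with ⟨hFℱ, hxF⟩
        rcases Finset.mem_filter.1 hF' with ⟨hF'ℱ, hxF'⟩
        refine ⟨F, hFℱ, F', hF'ℱ, ?_, ?_, ?_⟩
        · exact Finset.insert_subset hxF (hSG.trans (Finset.erase_subset _ _))
        · rw [Finset.disjoint_insert_left]
          exact ⟨hxF', hSF'⟩
        · intro y hy
          rw [List.takeWhile_cons_of_neg (by simp)] at hy
          simp at hy

end Literature.Combinatorics.SetFamily
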